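import Summits.HodgeConjecture.HodgeConjecture.Theorems.R90S3HPacketTypeHomogeneitySteinberg
import HarnessLib

/-!
# R90 · S3 · hand p05 §T3 — TYPE HOMOGENEITY of Rogawski `H_v`-packets, irreducible-principal-series type: such packets are singletons

R90-TF SLAB (brief v2 1f40d54518340a35), section S3, dealer R90-C12-plan (g0); hand p05 RE-SCOPED by RULING S3-R3 «ORBIT HOMOGENEITY» (R90 bus
2026-09-04T15:50:18Z, 15:56:37Z: «the irreducible-PS analogue (conjugate of a constituent of an irreducible `cmPrincipalSeries … (torusCharPair …)` is a constituent
of an irreducible one)»); seat K2E1-p11 (g3); crux H413 = `stmt-HodgeConjecture-24833`, route `HCCMUnconditional`, lane `--supports … --as helper`.  Third file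
of the homogeneity series (★ §T1 `R90S3HPacketTypeHomogeneity`, ★ §T2 `R90S3HPacketTypeHomogeneitySteinberg`, ★ PS-SIMIL-TRANSPORT `R90S3PrincipalSeriesSimilTransport`).

T3 SPELLING OF RECORD (FILE D `R90_S3_EndoExpansionByTypeD.lean` `stub_R90_S3_endoExpansion_indPS`, typ1 v1, dealer 16:07:19Z W3): member-level,
`∃ χ₂ χ₁, IsOpen ker χ₁ ∧ (cmPrincipalSeriesH L v χ₂ χ₁).IsIrreducible ∧ σ.IsConstituentOf (cmPrincipalSeriesH L v χ₂ χ₁)`.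

THE MATHEMATICS.  `ρ = O ⊠ χ` (S4-B `IsRogPacketH`), `σ = c ⊠ χ ∈ ρ` a constituent of the IRREDUCIBLE `i_H(χ₂ ⊠ χ₁′)`.  By ★ §T2's rigidity
`eq_of_boxChar_isConstituentOf_twist`, `χ₁′ = χ`; every member `τ = (c ∘ Ad T) ⊠ χ` (★ `u2SimilConj_symm∕_trans`) is again a constituent of `i_H(χ₂ ⊠ χ)` (★
PS-SIMIL-TRANSPORT `boxChar_comap_simil_isConstituentOf_cmPrincipalSeriesH_iff`), and an irreducible representation has at most one constituent (★
`IsConstituentOf.eq_of_isIrreducible`): `τ = σ`.  So **irreducible-PS packets are singletons** [Rogawski1990, §11.1 p. 161: «`ρ` consists of one element unless …»],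
and every member is of type T3 with the SAME `(χ₂, χ₁)`.  NAME-SHAPE (CONVENTIONS §2): `IsRogPacketH` and the T3 spelling unfolded byte for byte; by-import probe at HOME.

* (T3) `eq_singleton_of_mem_of_indPS`, `indPS_of_mem_of_exists`.

HONEST LABEL: HC_CM is proved only modulo the 7 printed citations (2 remaining named inputs: hLiu418 = stmt-HodgeConjecture-24832, h413 = stmt-HodgeConjecture-24833)
until rung 0 closes; sorry-free local representation theory, no printed theorem of Ch. 13 discharged; REL ≠ ★ ≠ BUILT.

## References
* [Rogawski1990] J. D. Rogawski, *Automorphic Representations of Unitary Groups in Three Variables*, Ann. of Math. Stud. 123 (1990): §11.1 p. 161, Prop. 11.1.1 (b);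
  §12.1 pp. 171–172; §12.2 p. 173.
* [BushnellHenniart2006] C. J. Bushnell, G. Henniart, *The Local Langlands Conjecture for GL(2)*, Grundlehren 335 (2006), §1.1, §9.1.
-/

set_option autoImplicit false
-- the mandated namespace repeats the single-problem summit's segment (`HodgeConjecture.HodgeConjecture`)
set_option linter.dupNamespace false

noncomputable section

open NumberField IsDedekindDomain
open scoped Matrix MatrixGroups
open Literature.NumberTheory.Automorphic Literature.NumberTheory.Automorphic.UnitaryGroup

namespace Summit.HodgeConjecture.HodgeConjecture.R90.S3

section CM

variable (L : Type) [Field L] [NumberField L] [IsCMField L] (v : HeightOneSpectrum (𝓞 ↥(maximalRealSubfield L)))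

set_option maxHeartbeats 400000 in
/-- **(T3, sharp form) a Rogawski `H_v`-packet containing a constituent of an IRREDUCIBLE `i_H(χ₂ ⊠ χ₁)` is the singleton of that member** (FILE D's T3 spelling,
unfolded): rigidity `χ₁′ = χ`, PS-SIMIL-TRANSPORT, and «an irreducible representation has at most one constituent».
[cite: Rogawski1990, §11.1 p. 161; §12.1 pp. 171–172; §12.2 p. 173] [cite: BushnellHenniart2006, §1.1] -/
theorem eq_singleton_of_mem_of_indPS
    (ρ : Finset (IrrClass ((cmDatum L 2 (Matrix.of fun i j : Fin 2 => if i.val + j.val + 1 = 2 then (1 : L) else 0)).Local v ×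
      (cmDatum L 1 (Matrix.of fun i j : Fin 1 => if i.val + j.val + 1 = 1 then (1 : L) else 0)).Local v)))
    (hρ : ∃ (O : Finset (IrrClass ((cmDatum L 2 (Matrix.of fun i j : Fin 2 => if i.val + j.val + 1 = 2 then (1 : L) else 0)).Local v)))
        (χ : (cmDatum L 1 (Matrix.of fun i j : Fin 1 => if i.val + j.val + 1 = 1 then (1 : L) else 0)).Local v →* ℂˣ)
        (hχ : IsOpen ((χ.ker : Subgroup ((cmDatum L 1 (Matrix.of fun i j : Fin 1 => if i.val + j.val + 1 = 1 then (1 : L) else 0)).Local v)) :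
          Set ((cmDatum L 1 (Matrix.of fun i j : Fin 1 => if i.val + j.val + 1 = 1 then (1 : L) else 0)).Local v))),
        (∃ σ : IrrClass ((cmDatum L 2 (Matrix.of fun i j : Fin 2 => if i.val + j.val + 1 = 2 then (1 : L) else 0)).Local v),
          σ.IsAdmissible ∧ ∀ c, c ∈ O ↔
            ∃ (T : GL (Fin 2) (LocalRing L v)) (a : LocalRing L v) (ha : IsUnit a)
              (h : formCongr (conjLocal L (IsCMField.complexConj L) v) T
                  ((Matrix.of fun i j : Fin 2 => if i.val + j.val + 1 = 2 then (1 : L) else 0).map (algebraMap L (LocalRing L v))) =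
                a • (Matrix.of fun i j : Fin 2 => if i.val + j.val + 1 = 2 then (1 : L) else 0).map (algebraMap L (LocalRing L v))),
              c = IrrClass.comap (cmDatumLocalCongr L v T ha h) σ) ∧
        ρ = O.map ⟨IrrClass.boxChar χ hχ, IrrClass.boxChar_injective χ hχ⟩)
    {σ : IrrClass ((cmDatum L 2 (Matrix.of fun i j : Fin 2 => if i.val + j.val + 1 = 2 then (1 : L) else 0)).Local v ×
      (cmDatum L 1 (Matrix.of fun i j : Fin 1 => if i.val + j.val + 1 = 1 then (1 : L) else 0)).Local v)}
    (hσ : σ ∈ ρ)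
    (h3 : ∃ (χ₂ : ↥(torusU (conjLocal L (IsCMField.complexConj L) v) (cmLocalForm L 2 v)) →* ℂˣ)
        (χ₁ : (cmDatum L 1 (Matrix.of fun i j : Fin 1 => if i.val + j.val + 1 = 1 then (1 : L) else 0)).Local v →* ℂˣ),
        IsOpen ((χ₁.ker : Subgroup ((cmDatum L 1 (Matrix.of fun i j : Fin 1 => if i.val + j.val + 1 = 1 then (1 : L) else 0)).Local v)) :
          Set ((cmDatum L 1 (Matrix.of fun i j : Fin 1 => if i.val + j.val + 1 = 1 then (1 : L) else 0)).Local v)) ∧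
        (cmPrincipalSeriesH L v χ₂ χ₁).IsIrreducible ∧ σ.IsConstituentOf (cmPrincipalSeriesH L v χ₂ χ₁)) :
    ρ = {σ} := by
  obtain ⟨O, χ, hχ, ⟨σ₀, -, hO⟩, rfl⟩ := hρ
  obtain ⟨c, hcO, hc⟩ := Finset.mem_map.1 hσ
  change IrrClass.boxChar χ hχ c = σ at hc
  subst hc
  obtain ⟨χ₂, χ₁', -, hirr, hmem⟩ := h3
  -- (1) the twisting character of the principal series IS the packet's box character
  obtain rfl : χ = χ₁' := (eq_of_boxChar_isConstituentOf_twist c hχ hmem).symm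
  haveI := hirr
  -- (2) every member is a constituent of the same irreducible `i_H(χ₂ ⊠ χ)`, hence equal to `σ`
  refine Finset.eq_singleton_iff_unique_mem.2 ⟨hσ, fun τ hτ => ?_⟩
  obtain ⟨c', hc'O, rfl⟩ := Finset.mem_map.1 hτ
  change IrrClass.boxChar χ hχ c' = IrrClass.boxChar χ hχ c
  have hrel := Summit.HodgeConjecture.HodgeConjecture.R90.S4.u2SimilConj_trans L v
    (Summit.HodgeConjecture.HodgeConjecture.R90.S4.u2SimilConj_symm L v ((hO c).1 hcO)) ((hO c').1 hc'O)
  obtain ⟨T, a, ha, h, rfl⟩ := hrel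
  exact ((boxChar_comap_simil_isConstituentOf_cmPrincipalSeriesH_iff L v T ha h χ₂ χ hχ c).2 hmem).eq_of_isIrreducible hmem

/-- **(T3-homogeneity, the dealer's shape) if SOME member of a Rogawski `H_v`-packet is a constituent of an irreducible `i_H(χ₂ ⊠ χ₁)` (FILE D's T3 spelling),
EVERY member is** (immediate from the sharp form). [cite: Rogawski1990, §11.1 p. 161; §12.1 pp. 171–172] -/
theorem indPS_of_mem_of_exists
    (ρ : Finset (IrrClass ((cmDatum L 2 (Matrix.of fun i j : Fin 2 => if i.val + j.val + 1 = 2 then (1 : L) else 0)).Local v ×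
      (cmDatum L 1 (Matrix.of fun i j : Fin 1 => if i.val + j.val + 1 = 1 then (1 : L) else 0)).Local v)))
    (hρ : ∃ (O : Finset (IrrClass ((cmDatum L 2 (Matrix.of fun i j : Fin 2 => if i.val + j.val + 1 = 2 then (1 : L) else 0)).Local v)))
        (χ : (cmDatum L 1 (Matrix.of fun i j : Fin 1 => if i.val + j.val + 1 = 1 then (1 : L) else 0)).Local v →* ℂˣ)
        (hχ : IsOpen ((χ.ker : Subgroup ((cmDatum L 1 (Matrix.of fun i j : Fin 1 => if i.val + j.val + 1 = 1 then (1 : L) else 0)).Local v)) :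
          Set ((cmDatum L 1 (Matrix.of fun i j : Fin 1 => if i.val + j.val + 1 = 1 then (1 : L) else 0)).Local v))),
        (∃ σ : IrrClass ((cmDatum L 2 (Matrix.of fun i j : Fin 2 => if i.val + j.val + 1 = 2 then (1 : L) else 0)).Local v),
          σ.IsAdmissible ∧ ∀ c, c ∈ O ↔
            ∃ (T : GL (Fin 2) (LocalRing L v)) (a : LocalRing L v) (ha : IsUnit a)
              (h : formCongr (conjLocal L (IsCMField.complexConj L) v) T
                  ((Matrix.of fun i j : Fin 2 => if i.val + j.val + 1 = 2 then (1 : L) else 0).map (algebraMap L (LocalRing L v))) =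
                a • (Matrix.of fun i j : Fin 2 => if i.val + j.val + 1 = 2 then (1 : L) else 0).map (algebraMap L (LocalRing L v))),
              c = IrrClass.comap (cmDatumLocalCongr L v T ha h) σ) ∧
        ρ = O.map ⟨IrrClass.boxChar χ hχ, IrrClass.boxChar_injective χ hχ⟩)
    (hex : ∃ σ ∈ ρ, ∃ (χ₂ : ↥(torusU (conjLocal L (IsCMField.complexConj L) v) (cmLocalForm L 2 v)) →* ℂˣ)
        (χ₁ : (cmDatum L 1 (Matrix.of fun i j : Fin 1 => if i.val + j.val + 1 = 1 then (1 : L) else 0)).Local v →* ℂˣ),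
        IsOpen ((χ₁.ker : Subgroup ((cmDatum L 1 (Matrix.of fun i j : Fin 1 => if i.val + j.val + 1 = 1 then (1 : L) else 0)).Local v)) :
          Set ((cmDatum L 1 (Matrix.of fun i j : Fin 1 => if i.val + j.val + 1 = 1 then (1 : L) else 0)).Local v)) ∧
        (cmPrincipalSeriesH L v χ₂ χ₁).IsIrreducible ∧ σ.IsConstituentOf (cmPrincipalSeriesH L v χ₂ χ₁)) :
    ∀ σ ∈ ρ, ∃ (χ₂ : ↥(torusU (conjLocal L (IsCMField.complexConj L) v) (cmLocalForm L 2 v)) →* ℂˣ)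
        (χ₁ : (cmDatum L 1 (Matrix.of fun i j : Fin 1 => if i.val + j.val + 1 = 1 then (1 : L) else 0)).Local v →* ℂˣ),
        IsOpen ((χ₁.ker : Subgroup ((cmDatum L 1 (Matrix.of fun i j : Fin 1 => if i.val + j.val + 1 = 1 then (1 : L) else 0)).Local v)) :
          Set ((cmDatum L 1 (Matrix.of fun i j : Fin 1 => if i.val + j.val + 1 = 1 then (1 : L) else 0)).Local v)) ∧
        (cmPrincipalSeriesH L v χ₂ χ₁).IsIrreducible ∧ σ.IsConstituentOf (cmPrincipalSeriesH L v χ₂ χ₁) := by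
  obtain ⟨σ, hσ, h3⟩ := hex
  have hρσ := eq_singleton_of_mem_of_indPS L v ρ hρ hσ h3
  intro τ hτ
  rw [hρσ, Finset.mem_singleton] at hτ
  rw [hτ]
  exact h3

end CM

end Summit.HodgeConjecture.HodgeConjecture.R90.S3

end
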